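import Summits.BirchSwinnertonDyer.BirchSwinnertonDyer.Theorems.ManinLocalTwoThreeNeronSqueezeNinetySixA
import Summits.BirchSwinnertonDyer.BirchSwinnertonDyer.Theorems.ManinLocalTwoThreeNeronSqueezeNinetySixB
import HarnessLib

/-!
# Level 96 (`v₂(N) = 5`): `|c| = 1`, `2 ∤ c`, `3 ∤ c` for EVERY `X₀(96)`-datum, MODULO THE NEWFORM PINNING `⇑D.f ∈ {φ₉₆ₐ, φ₉₆_b}`

Cell bsd-f2-manin, route `ManinLocalTwoThree` (crux C2 `ManinOddAtFour` stmt-22967), prover seat p3 gen 24.  The two class squeezes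
(`NeronSqueezeNinetySixA.abs_maninConstant_eq_one_ninetySixA_of_f_eq`, `NeronSqueezeNinetySixB.abs_maninConstant_eq_one_ninetySixB_of_f_eq`,
both UNCONDITIONAL) assembled under the single remaining hypothesis at level `96`: the PINNING `hpin` — every `X₀(96)`-datum's normalised
newform is `φ₉₆ₐ = B₂ + B₃ + B₄ + 2B₅` or `φ₉₆_b = 4B₁ − B₂ + B₃ + B₄ + 2B₅` on an-g51's `η`-basis (a finite statement about the
`9`-dimensional `S₂(Γ₀(96))` and its two newforms; an's exclusion certificate pinsolve-96; NOT proved here, NOT a named fact — a hypothesis).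

HONEST FRAMING: conditional on `hpin` only (no `mazur…`, `abbesUllmo…`, `cesnavicius…`, `exists_isNewformOf`); the `∀ N` crux C2, Manin's
conjecture and BSD are NOT proved; item 22967 stays OPEN as filed.  No definition, no named fact, no sorry. [cite: AgasheRibetStein2006, §§1–2]
-/

set_option autoImplicit false
-- lint-debt: the directory name repeats the summit name (sibling precedent `ManinLocalTwoThreeNeronSqueezeNinetySixA.lean`)
set_option linter.dupNamespace false

noncomputable section

open Complex
open UpperHalfPlane hiding I
open scoped MatrixGroups ModularForm
open ModularForm CongruenceSubgroup WeierstrassCurve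
open Literature.NumberTheory.EllipticCurves Literature.NumberTheory.EllipticCurves.ModularForms

namespace Summit.BirchSwinnertonDyer.BirchSwinnertonDyer.Theorems.ManinLocalTwoThree.ManinConstantNinetySix

/-- **C2 at `N = 96` for EVERY datum, MODULO THE PINNING**: if every `X₀(96)`-datum has normalised newform `φ₉₆ₐ` or `φ₉₆_b`, then for every
globally minimal elliptic `W/ℚ` and every `X₀(96)`-datum `D` of `W` with the lattice clause: `|c(D)| = 1`, `2 ∤ c(D)`, `3 ∤ c(D)`.
[cite: AgasheRibetStein2006, §§1–2] -/
theorem maninConstant_ninetySix_of_pinning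
    (hpin : ∀ (W : WeierstrassCurve ℚ) [W.IsElliptic] (D : ModularParametrizationData W 96),
      (⇑D.f = fun τ ↦ (etaQuotient 96 (expFn [(4, 2), (8, -3), (12, -4), (16, 1), (24, 11), (48, -3)]) τ + etaQuotient 96 (expFn [(4, 1), (8, -1), (12, -1), (24, 3), (32, 2), (48, 2), (96, -2)]) τ + etaQuotient 96 (expFn [(4, 1), (8, -3), (12, -1), (16, 6), (24, 5), (32, -2), (48, -4), (96, 2)]) τ + 2 * etaQuotient 96 (expFn [(2, 1), (4, -2), (6, -3), (8, 2), (12, 8), (16, -1), (24, -4), (48, 3)]) τ)) ∨ (⇑D.f = fun τ ↦ (4 * etaQuotient 96 (expFn [(4, 1), (12, -1), (16, -1), (24, 2), (48, 3)]) τ - etaQuotient 96 (expFn [(4, 2), (8, -3), (12, -4), (16, 1), (24, 11), (48, -3)]) τ + etaQuotient 96 (expFn [(4, 1), (8, -1), (12, -1), (24, 3), (32, 2), (48, 2), (96, -2)]) τ + etaQuotient 96 (expFn [(4, 1), (8, -3), (12, -1), (16, 6), (24, 5), (32, -2), (48, -4), (96, 2)]) τ + 2 * etaQuotient 96 (expFn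 [(2, 1), (4, -2), (6, -3), (8, 2), (12, 8), (16, -1), (24, -4), (48, 3)]) τ)))
    (W : WeierstrassCurve ℚ) [W.IsElliptic] [W.IsGloballyMinimal] (D : ModularParametrizationData W 96)
    (hopt : ∀ z ∈ D.L.lattice, ∃ w ∈ periodLattice D.f, z = D.c * w) :
    |D.maninConstant| = 1 ∧ ¬ (2 : ℤ) ∣ D.maninConstant ∧ ¬ (3 : ℤ) ∣ D.maninConstant := by
  rcases hpin W D with h | h
  · exact ⟨NeronSqueezeNinetySixA.abs_maninConstant_eq_one_ninetySixA_of_f_eq W D h hopt,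
      NeronSqueezeNinetySixA.not_dvd_maninConstant_ninetySixA_of_f_eq W D h hopt⟩
  · exact ⟨NeronSqueezeNinetySixB.abs_maninConstant_eq_one_ninetySixB_of_f_eq W D h hopt,
      NeronSqueezeNinetySixB.not_dvd_maninConstant_ninetySixB_of_f_eq W D h hopt⟩

end Summit.BirchSwinnertonDyer.BirchSwinnertonDyer.Theorems.ManinLocalTwoThree.ManinConstantNinetySix

end
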